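import Summits.HodgeConjecture.HodgeConjecture.Theorems.Ring2AbelianAllWeilCellsBlochSeed
import Summits.HodgeConjecture.HodgeConjecture.Theorems.Ring2HypothesesWeilComponentsLadder
import Summits.HodgeConjecture.HodgeConjecture.Theorems.Ring2AbelianAllNonsplitNormObstruction
import Summits.HodgeConjecture.HodgeConjecture.Theorems.WeilTypeLadderOnPath
import Literature.AlgebraicGeometry.HodgeTheory.WeilClassesSixfoldsSqrtMinus3Schoen
import Literature.AlgebraicGeometry.VanGeemen1994.WeilDiscriminantOfHyperbolic
import HarnessLib

/-!
# NSC(−2) · the COMPONENT file (P2-NSC-1 (ii), prover 2 gen 33): the cell target `WeilClassesComponent 3 3 [−2]` from the seed door,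
# from the anchor door, from stmt-2524, from the summit, and its place inside R1′ `NonsplitSixfolds`

Family `hodge`, b2b cell `hweil`, NSC programme (packet `run/shared/lean/b2b/hodge-weil/LADDER.md ## CARVER v131` C803 (a)/(d)(ii), `v132` C807 (a)).
Helper of item stmt-HodgeConjecture-2524; an `Nsc` file in the sense of the cell's import ruling (imports ring-2 modules
`Ring2AbelianAllWeilCellsBlochSeed`, `Ring2HypothesesWeilComponentsLadder`, `Ring2AbelianAllNonsplitNormObstruction` — component vocabulary
and fact-free doors; the two named print facts below enter as BINDERS, never as axioms).

THE TARGET. NSC(−2) := `Ring2.Hypotheses.WeilClassesComponent 3 3 [−2]`, `[−2] := QuotientGroup.mk (Units.mk0 (-2 : ℚ) _) :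
weilNormResidueGroup 3` — the Weil classes on EVERY polarized `ℚ(√−3)`-Weil abelian sixfold `(A, φ, h_K = 3·e^*a + φ^*e^*a)` whose
Hermitian form has discriminant class `det H = [−2] ∈ ℚˣ/Nm(ℚ(√−3)ˣ)` are algebraic.

WHAT IS PROVED (0 sorry, def-free; every head a one-line specialisation whose value is the typed statement it creates):
* `nsc_minusTwo_of_seed` — **NSC(−2) ⟸ `weilFamilyReach_similar` ∧ `BlochSemiregularSpread 6 3` ∧ `HasBlochSeedInClass 3 3 [−2]`**
  (ring-2's door `weilClassesComponent_of_reachSimilar_of_blochSpread_of_seedInClass` at `(3, 3, [−2])`): the cell target from Deligne's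
  reach-by-similitude (refereed, named binder), Bloch's semiregularity theorem in class-level form (refereed, named binder) and ONE OBJECT —
  an integral Bloch-semiregular lci threefold carrying `q·h_K³ + w` on one member of the component. CONDITIONAL on the two named facts.
* `nsc_minusTwo_of_anchor` — the same through the sheaf door: `weilFamilyReach_similar` ∧ `HasLocallyAlgebraicWeilAnchorInClass 3 3 [−2]` ⟹ NSC(−2).
* `nsc_minusTwo_of_weilSixfolds` — NSC(−2) is a SLICE of item stmt-2524 (`Theses.SevenfoldWeilCensus.WeilSixfolds`).
* `nsc_minusTwo_of_hodgeConjecture` — ON-PATH: NSC(−2) is a CASE of the summit.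
* `nsc_minusTwo_of_nonsplitSixfolds_of_schoen` — **NSC(−2) INSIDE R1′**: `Schoen1998_weilClasses_algebraic_hyperbolicSixfold_three` (REFEREED split cell
  `(3, 3, [−1])`, named binder) ∧ R1′ `WeilTypeLadder.NonsplitSixfolds` ⟹ NSC(−2) — a member of class `[−2]` either admits NO hyperbolic
  `K`-symmetrised polarization (then it is a point of R1′'s locus) or admits one (then Schoen's theorem applies to it); `[−2]` itself is never
  the class of a hyperbolic polarization (`nsc_minusTwo_component_nonsplit`: `[−2] ≠ [(−1)³]`, `2 ∉ Nm(ℚ(√−3)ˣ)`, ring-2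
  `negTwo_ne_splitDiscriminantClass` + van Geemen (5.4.1) on the carriers).

HONEST FRAMING: implications between NAMED typed statements; nothing here is a rung, a case proved, or evidence for NSC(−2); 0 unconditional
rungs; `HC_CM` occurs nowhere; [Markman 2025] (arXiv:2502.03415 / 2509.23403, unrefereed) is cited for the invariant `(n, K, det H)` only and used
as a fact nowhere. [cite: vanGeemen1994HodgeAV, 4.14, Lemma 5.2, 5.3 and (5.4.1)] [cite: Deligne1982HodgeCycles, proof of Thm. 4.8]
[cite: Bloch1972Semiregularity, Thm. (7.4) and Remark (7.5)] [cite: Schoen1998HodgeWeilAddendum]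
-/

noncomputable section

-- mandated namespace `Summit.HodgeConjecture.HodgeConjecture.…` (Problem = Summit) trips `linter.dupNamespace`; the lakefile disables it
-- tree-wide (weak option), restated here so stand-alone elaboration is warning-free too.
set_option linter.dupNamespace false

open CategoryTheory
open Literature.AlgebraicGeometry Literature.AlgebraicGeometry.Motives
open Literature.AlgebraicGeometry.HodgeTheory
open Literature.AlgebraicGeometry.VanGeemen1994
open Literature.AlgebraicTopology.SingularHomology
open Summit.HodgeConjecture.HodgeConjecture.Ring2.Hypotheses
open Summit.HodgeConjecture.HodgeConjecture.Ring2.AbelianAll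
open Summit.HodgeConjecture.Ring2AbelianAll.NonsplitNormObstruction (negTwo_ne_splitDiscriminantClass)

namespace Summit.HodgeConjecture.HodgeConjecture.WeilTypeLadder

section NscComponentMinusTwo

/-- **NSC(−2) from the SEED door** (C803 (a)'s chain, kernel-checked at the cell's indices): Deligne's reach-by-similitude
`weilFamilyReach_similar` ∧ Bloch's class-level semiregularity theorem `BlochSemiregularSpread 6 3` ∧ ONE Bloch seed in the component
`HasBlochSeedInClass 3 3 [−2]` ⟹ `WeilClassesComponent 3 3 [−2]`. CONDITIONAL on the two named print facts (binders).
[cite: Deligne1982HodgeCycles, proof of Thm. 4.8] [cite: Bloch1972Semiregularity, Thm. (7.4) and Remark (7.5)] [cite: vanGeemen1994HodgeAV, Lemma 5.2 and Thm. 5.3] -/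
theorem nsc_minusTwo_of_seed (hF : weilFamilyReach_similar) (hB : BlochSemiregularSpread 6 3)
    (hS : HasBlochSeedInClass 3 3 (QuotientGroup.mk (Units.mk0 (-2 : ℚ) (by norm_num)))) :
    WeilClassesComponent 3 3 (QuotientGroup.mk (Units.mk0 (-2 : ℚ) (by norm_num))) :=
  weilClassesComponent_of_reachSimilar_of_blochSpread_of_seedInClass hF (by norm_num) (by norm_num) hB hS

/-- **NSC(−2) from the ANCHOR (sheaf) door**: `weilFamilyReach_similar` ∧ ONE locally algebraic anchor in the component
`HasLocallyAlgebraicWeilAnchorInClass 3 3 [−2]` ⟹ `WeilClassesComponent 3 3 [−2]` (ring-2 part 9). CONDITIONAL on the named fact.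
[cite: Deligne1982HodgeCycles, proof of Thm. 4.8] [cite: vanGeemen1994HodgeAV, Lemma 5.2 and Thm. 5.3] -/
theorem nsc_minusTwo_of_anchor (hF : weilFamilyReach_similar)
    (hP : HasLocallyAlgebraicWeilAnchorInClass 3 3 (QuotientGroup.mk (Units.mk0 (-2 : ℚ) (by norm_num)))) :
    WeilClassesComponent 3 3 (QuotientGroup.mk (Units.mk0 (-2 : ℚ) (by norm_num))) :=
  weilClassesComponent_of_reachSimilar_of_anchorInClass hF (by norm_num) (by norm_num) hP

/-- **NSC(−2) is a SLICE of item stmt-2524** (`WeilSixfolds`: all Weil classes on all `ℚ(√−d)`-Weil sixfolds): forget the polarization and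
its discriminant. [cite: Weil1977HodgeRing] [cite: vanGeemen1994HodgeAV, Lemma 5.2] -/
theorem nsc_minusTwo_of_weilSixfolds (h : Theses.SevenfoldWeilCensus.WeilSixfolds) :
    WeilClassesComponent 3 3 (QuotientGroup.mk (Units.mk0 (-2 : ℚ) (by norm_num))) :=
  fun A φ hA hX hφ _ _ _ _ _ c hcQ hcH hcW ↦ weilSixfolds_iff_weilClassesOf.1 h 3 (by norm_num) A φ hA hX hφ c hcQ hcH hcW

/-- **ON-PATH: NSC(−2) is a CASE of the summit** (`HodgeConjecture → WeilClassesComponent 3 3 [−2]`). [cite: Deligne2000, §1] -/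
theorem nsc_minusTwo_of_hodgeConjecture (h : _root_.HodgeConjecture) :
    WeilClassesComponent 3 3 (QuotientGroup.mk (Units.mk0 (-2 : ℚ) (by norm_num))) :=
  weilClassesComponent_of_hodgeConjecture h 3 3 _

/-- **The component is of NON-SPLIT type**: `[−2] ≠ [(−1)³] = splitDiscriminantClass 3 3` (`2 ∉ Nm(ℚ(√−3)ˣ)`, ring-2), hence NO polarized
member `(A, φ, h_K)` of class `[−2]` is hyperbolic for its `h_K` (van Geemen (5.4.1) ⟹, on the carriers:
`not_isHyperbolicWeilType_of_hasWeilDiscriminantNondeg_ne`). [cite: vanGeemen1994HodgeAV, Lemma 5.2 (3) and (5.4.1)]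
[cite: Markman2025SurveySecant, §11.5 Step 1 (the invariant; preprint/survey, no result used)] -/
theorem nsc_minusTwo_component_nonsplit :
    (QuotientGroup.mk (Units.mk0 (-2 : ℚ) (by norm_num)) : weilNormResidueGroup 3) ≠ splitDiscriminantClass 3 3 ∧
    ∀ (A : AbelianVariety ℂ) (φ : A ⟶ A), A.dim = 2 * 3 → φ ≫ φ = -((3 : ℕ) • 𝟙 A) →
      ∀ (e : ProjectiveEmbedding A.X) (a : complexBetti (projectiveSpace e.n ℂ) 2), IsRationalClass a → a ≠ 0 →
        HasWeilDiscriminantNondeg A φ 3 3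
          (((3 : ℕ) : ℂ) • complexBetti.map e.ι 2 a + complexBetti.map φ.hom.hom.hom 2 (complexBetti.map e.ι 2 a))
          (QuotientGroup.mk (Units.mk0 (-2 : ℚ) (by norm_num))) →
        ¬ IsHyperbolicWeilType A φ 3
          (((3 : ℕ) : ℂ) • complexBetti.map e.ι 2 a + complexBetti.map φ.hom.hom.hom 2 (complexBetti.map e.ι 2 a)) :=
  ⟨negTwo_ne_splitDiscriminantClass, fun _ _ hA hφ e _ ha ha0 hδ ↦
    not_isHyperbolicWeilType_of_hasWeilDiscriminantNondeg_ne (by norm_num) hA (by norm_num) hφ e ha ha0 hδ negTwo_ne_splitDiscriminantClass⟩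

/-- **NSC(−2) INSIDE R1′** (modulo the REFEREED split cell `(3, 3, [−1])`): `Schoen1998_weilClasses_algebraic_hyperbolicSixfold_three` ∧
`NonsplitSixfolds` ⟹ `WeilClassesComponent 3 3 [−2]`. A member `(A, φ, h_K)` of class `[−2]` carrying the rational `(3,3)` Weil class `c`:
EITHER `(A, φ)` admits no hyperbolic `K`-symmetrised hyperplane class at all — then it is a point of R1′'s locus and R1′ gives `c` algebraic —
OR it admits one, `h′_K = 3·e′^*a′ + φ^*e′^*a′` hyperbolic — then Schoen's theorem (the general `ℚ(√−3)`-Weil sixfold with `det H = 1` in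
van Geemen's normalisation, i.e. hyperbolic; Schoen 1988 Thm. 0.2 + 1998 addendum, as typed) gives `c` algebraic. (Only this direction: one
`(A, φ)` may carry polarizations of several discriminant classes, e.g. the CM member `(E₀ × E₀)³` carries `[−2]` at weights `(2,1,1,1,1,1)` and
`[−1]` at weights `(1,…,1)`.) [cite: Schoen1988HodgeWeil, Thm. 0.2 and §3] [cite: Schoen1998HodgeWeilAddendum] [cite: vanGeemen1994HodgeAV, 7.3 and (5.4.1)] -/
theorem nsc_minusTwo_of_nonsplitSixfolds_of_schoen (hS : Schoen1998_weilClasses_algebraic_hyperbolicSixfold_three)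
    (hR : NonsplitSixfolds) :
    WeilClassesComponent 3 3 (QuotientGroup.mk (Units.mk0 (-2 : ℚ) (by norm_num))) := by
  intro A φ hA hX hφ _ _ _ _ _ c hcQ hcH hcW
  by_cases hhyp : ∃ (e' : ProjectiveEmbedding A.X) (a' : complexBetti (projectiveSpace e'.n ℂ) 2),
      IsRationalClass a' ∧ a' ≠ 0 ∧
        IsHyperbolicWeilType A φ 3
          (((3 : ℕ) : ℂ) • complexBetti.map e'.ι 2 a' + complexBetti.map φ.hom.hom.hom 2 (complexBetti.map e'.ι 2 a'))
  · obtain ⟨e', a', ha', ha'0, hh⟩ := hhyp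
    exact hS A φ hA hX hφ e' a' ha' ha'0 hh c hcQ hcH hcW
  · exact hR 3 (by norm_num) A φ hA hX hφ (fun e' a' ha' ha'0 hh ↦ hhyp ⟨e', a', ha', ha'0, hh⟩) c hcQ hcH hcW

end NscComponentMinusTwo

end Summit.HodgeConjecture.HodgeConjecture.WeilTypeLadder

end
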